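import Mathlib
import Summits.NavierStokesRegularity.NavierStokesRegularity.Theorems.DssFarFieldSlavingBlowupTypeIDssProfileSimilarityEnstrophyMixedCore
import Literature.Analysis.FluidPDE.LerayProfileCalculus
import Literature.Analysis.FluidPDE.DecayingSelfSimilarEulerProfile
import HarnessLib

/-!
# Λ-WRAPPER CORE (label-free kit): the Lamb form of the vortex stretching and the whole-space
  `div`–`curl` `L²` identity for the similarity vorticity
  (pub-ns-dss theory SLAVING-GAP v1.0 72f3b541885680df §5.1 / §5.4 (b); lead A503 (b), A504 (b)(c); route
  `DssFarFieldSlaving`, crux `BlowupTypeIDssProfile`, stmt-NavierStokesRegularity-0155 — SUPPORT, label-free kit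
  for a later threshold file; typer seat g14, 2026-08-25)

HONEST FRAMING. Analysis lemmas about a HYPOTHETICAL object (a KNSS-gauge Type-I field `V`,
`IsTypeIAncientMild M V`, in similarity variables `U = lerayOrbit V`, `Ω = lerayVorticity V = curl U`) under the
scale-invariant gauge bounds (D) of orders `1, 2` taken as NAMED hypotheses. NO class statement, NO threshold, NO
census word is asserted here; nothing numeric; nothing here bears on Navier–Stokes regularity or blow-up.

CONTENTS (all folklore vector calculus, written against the tree's `cross`, `curl`, `convect`, `frobeniusNormSq`):
* `cross_eq_neg_cross_swap` — antisymmetry of the tree's `cross` on `EuclideanSpace ℝ (Fin 3)` (the bound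
  `‖a × b‖ ≤ ‖a‖‖b‖` is the Literature lemma `norm_cross_le_norm_mul_norm`, and Majda–Bertozzi (1.24) in inner
  form, `⟪curl W(y) × a, b⟫ = ⟪b, DW(y) a⟫ − ⟪a, DW(y) b⟫`, is the Literature lemma `inner_cross_curl_left` — both
  REUSED, not restated, per the gate's dedup);
* `inner_convect_self_eq_sub` — pointwise `⟪U, (W·∇)W⟫ = ⟪(U·∇)W, W⟫ − ⟪U, W × curl W⟫`
  (`(W·∇)W = ∇(|W|²/2) − W × curl W` paired with `U`);
* **`integral_stretching_eq_integral_inner_lamb`** (S2 form of the stretching):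
  `Str(s) = ∫⟪Ω, DU Ω⟫ = ∫⟪U, Ω × curl Ω⟫` — the tree's integration by parts
  `integral_inner_convect_eq_neg_integral_inner_convect_self` (`= −∫⟪U,(Ω·∇)Ω⟫`), the pointwise identity, and
  `∫⟪(U·∇)Ω, Ω⟫ = 0` (`integral_inner_convect_self_eq_zero`), with `integrable_inner_lerayOrbit_lamb`;
* **`integral_norm_curl_sq_eq_integral_frobeniusNormSq`** (generic) and its instance
  **`integral_norm_curl_lerayVorticity_sq_eq`**: `∫‖curl Ω(s)‖² = ∫|∇Ω(s)|²_F` for the divergence-free, decaying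
  similarity vorticity — pointwise `|DW|²_F = ‖curl W‖² + tr(DW∘DW)` (`frobeniusNormSq_fderiv_eq_sq_norm_curl_add_trace`),
  `tr(DW∘DW) = div((W·∇)W)` for `div W = 0` (`divergence_convect_self_eq`) and `∫div = 0` for an `L¹` field with `L¹`
  divergence (`integral_divergence_eq_zero_of_integrable`); integrability from (D)₁₂
  (`integrable_norm_curl_lerayVorticity_sq`, `integrable_convect_lerayVorticity_self`).
This is the step that lets a Λ-directional stretching bound keep the Young coefficient `θ²/4` (threshold `1`)
instead of the pointwise `‖curl W‖² ≤ 2|DW|²_F` (threshold `1/√2`). [this file; theory SLAVING-GAP §5]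
-/

noncomputable section

set_option linter.dupNamespace false

namespace Summit.NavierStokesRegularity.NavierStokesRegularity.Theorems.SimilarityEnstrophy

open MeasureTheory Set Filter Topology Module Metric InnerProductSpace Function
open scoped RealInnerProductSpace Laplacian ContDiff
open Literature.Analysis Literature.Analysis.FluidPDE
open Summit.NavierStokesRegularity.NavierStokesRegularity.Theorems.GaussianGap
open Summit.NavierStokesRegularity.NavierStokesRegularity.Theorems.PlanarEnergyAPriori

/-! ### Cross-product algebra on `ℝ³` (tree's `cross`) -/

/-- Antisymmetry of the tree's cross product on `EuclideanSpace ℝ (Fin 3)`: `a × b = −(b × a)`. [folklore] -/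
theorem cross_eq_neg_cross_swap (a b : EuclideanSpace ℝ (Fin 3)) : cross a b = -cross b a := by
  ext i
  fin_cases i <;> simp [cross, cross_apply] <;> ring

/-- **Pointwise Lamb decomposition of the transport pairing**: for fields `W, U : ℝ³ → ℝ³`,
`⟪U, (W·∇)W⟫ = ⟪(U·∇)W, W⟫ − ⟪U, W × curl W⟫` at every point (`(W·∇)W = ∇(|W|²/2) − W × curl W`
paired with `U`; from the Literature lemma `inner_cross_curl_left` (Majda–Bertozzi (1.24)) with
`(a, b) = (W(y), U(y))`). [folklore] -/
theorem inner_convect_self_eq_sub (W U : EuclideanSpace ℝ (Fin 3) → EuclideanSpace ℝ (Fin 3))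
    (y : EuclideanSpace ℝ (Fin 3)) :
    ⟪U y, convect W W y⟫ = ⟪convect U W y, W y⟫ - ⟪U y, cross (W y) (curl W y)⟫ := by
  have h := inner_cross_curl_left W y (W y) (U y)
  have h1 : ⟪fderiv ℝ W y (U y), W y⟫ = ⟪W y, fderiv ℝ W y (U y)⟫ := real_inner_comm _ _
  have h2 : ⟪U y, cross (W y) (curl W y)⟫ = -⟪cross (curl W y) (W y), U y⟫ := by
    rw [cross_eq_neg_cross_swap (W y) (curl W y), inner_neg_right, real_inner_comm]
  simp only [convect_apply]
  linarith

/-! ### The Lamb form of the stretching: `Str(s) = ∫⟪U, Ω × curl Ω⟫` -/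

variable {M : ℝ} {V : ℝ → EuclideanSpace ℝ (Fin 3) → EuclideanSpace ℝ (Fin 3)}

/-- `⟪U(s), Ω(s) × curl Ω(s)⟫ ∈ L¹(ℝ³)` under (D) at `k = 1, 2` (difference of the two integrable transport
pairings `⟪(U·∇)Ω, Ω⟫` and `⟪U, (Ω·∇)Ω⟫`). [folklore] -/
theorem integrable_inner_lerayOrbit_lamb (hV : IsTypeIAncientMild M V) {C₁ C₂ : ℝ}
    (hD1 : ∀ t < 0, ∀ x, (‖x‖ + Real.sqrt (-t)) ^ (1 + 1) * ‖iteratedFDeriv ℝ 1 (V t) x‖ ≤ C₁)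
    (hD2 : ∀ t < 0, ∀ x, (‖x‖ + Real.sqrt (-t)) ^ (2 + 1) * ‖iteratedFDeriv ℝ 2 (V t) x‖ ≤ C₂)
    (s : ℝ) :
    Integrable fun y =>
      ⟪lerayOrbit V s y, cross (lerayVorticity V s y) (curl (lerayVorticity V s) y)⟫ := by
  have iT := integrable_inner_lerayOrbit_convect_lerayVorticity hV hD1 hD2 s
  have iC := integrable_inner_convect_lerayVorticity hV hD1 hD2 s
  have hfun : (fun y => ⟪lerayOrbit V s y, cross (lerayVorticity V s y) (curl (lerayVorticity V s) y)⟫) =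
      fun y => ⟪convect (lerayOrbit V s) (lerayVorticity V s) y, lerayVorticity V s y⟫ -
        ⟪lerayOrbit V s y, convect (lerayVorticity V s) (lerayVorticity V s) y⟫ := by
    funext y
    rw [inner_convect_self_eq_sub (lerayVorticity V s) (lerayOrbit V s) y]
    ring
  rw [hfun]
  exact iC.sub iT

/-- **The stretching in Lamb form** (theory SLAVING-GAP §5.1, `Str = ∫det(U, Ω, curl Ω) = ∫U·Λ`,
`Λ := Ω × curl Ω`; the Lamb-vector form of the enstrophy production, Doering–Gibbon 1995 §1.4): for a
KNSS-gauge Type-I field under (D) at `k = 1, 2`,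
`∫⟪Ω(s), DU(s) Ω(s)⟫ = ∫⟪U(s), Ω(s) × curl Ω(s)⟫`. Proof: the tree's integration by parts
`∫⟪Ω, DU Ω⟫ = −∫⟪U, (Ω·∇)Ω⟫` (`div Ω = 0`, `U` bounded), the pointwise Lamb decomposition
`inner_convect_self_eq_sub`, and `∫⟪(U·∇)Ω, Ω⟫ = 0` (`div U = 0`, `integral_inner_convect_self_eq_zero`).
[this file; folklore] -/
theorem integral_stretching_eq_integral_inner_lamb (hV : IsTypeIAncientMild M V) {C₁ C₂ : ℝ}
    (hD1 : ∀ t < 0, ∀ x, (‖x‖ + Real.sqrt (-t)) ^ (1 + 1) * ‖iteratedFDeriv ℝ 1 (V t) x‖ ≤ C₁)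
    (hD2 : ∀ t < 0, ∀ x, (‖x‖ + Real.sqrt (-t)) ^ (2 + 1) * ‖iteratedFDeriv ℝ 2 (V t) x‖ ≤ C₂)
    (s : ℝ) :
    ∫ y, ⟪lerayVorticity V s y, fderiv ℝ (lerayOrbit V s) y (lerayVorticity V s y)⟫ =
      ∫ y, ⟪lerayOrbit V s y, cross (lerayVorticity V s y) (curl (lerayVorticity V s) y)⟫ := by
  have hΩ := contDiff_lerayVorticity_slice hV s
  have hU : ContDiff ℝ ∞ (lerayOrbit V s) := contDiff_lerayOrbit_slice_of_typeI hV s le_rfl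
  have hdivΩ : VectorCalculus.IsDivFree (lerayVorticity V s) := fun y =>
    divergence_curl_eq_zero_holds _ (hU.of_le (by norm_cast)) y
  have hdivU : VectorCalculus.IsDivFree (lerayOrbit V s) :=
    (isDivFree_lerayOrbit_iff V s).2 (hV.isDivFree (neg_neg_of_pos (Real.exp_pos _)))
  have iZ := integrable_norm_lerayVorticity_sq hV hD1 s
  have iS := integrable_inner_stretching_lerayVorticity hV hD1 s
  have iT := integrable_inner_lerayOrbit_convect_lerayVorticity hV hD1 hD2 s
  have iC := integrable_inner_convect_lerayVorticity hV hD1 hD2 s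
  have iΛ := integrable_inner_lerayOrbit_lamb hV hD1 hD2 s
  have iS' : Integrable fun y =>
      ⟪convect (lerayVorticity V s) (lerayOrbit V s) y, lerayVorticity V s y⟫ := by
    refine iS.congr (Eventually.of_forall fun y => ?_)
    simp only [convect_apply]
    exact real_inner_comm _ _
  have hIBP := integral_inner_convect_eq_neg_integral_inner_convect_self hΩ hU hdivΩ
    (fun y => norm_lerayOrbit_le_of_typeI hV s y) iZ iS' iT
  have hStr : ∫ y, ⟪lerayVorticity V s y, fderiv ℝ (lerayOrbit V s) y (lerayVorticity V s y)⟫ =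
      -∫ y, ⟪lerayOrbit V s y, convect (lerayVorticity V s) (lerayVorticity V s) y⟫ := by
    rw [← hIBP]
    refine integral_congr_ae (Eventually.of_forall fun y => ?_)
    simp only [convect_apply]
    exact real_inner_comm _ _
  have hT0 := integral_inner_convect_self_eq_zero hΩ hU hdivU
    (fun y => norm_lerayOrbit_le_of_typeI hV s y) iZ iC
  have hpt : ∀ y, ⟪lerayOrbit V s y, convect (lerayVorticity V s) (lerayVorticity V s) y⟫ =
      ⟪convect (lerayOrbit V s) (lerayVorticity V s) y, lerayVorticity V s y⟫ -
        ⟪lerayOrbit V s y, cross (lerayVorticity V s y) (curl (lerayVorticity V s) y)⟫ :=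
    fun y => inner_convect_self_eq_sub (lerayVorticity V s) (lerayOrbit V s) y
  rw [hStr, integral_congr_ae (Eventually.of_forall hpt), integral_sub iC iΛ, hT0]
  ring

/-! ### The whole-space `div`–`curl` `L²` identity -/

/-- **`∫‖curl W‖² = ∫|DW|²_F` for a divergence-free `C²` field on `ℝ³` with `|DW|²_F, ‖curl W‖² ∈ L¹` and
`(W·∇)W ∈ L¹`** (whole space, no boundary): pointwise `|DW|²_F = ‖curl W‖² + tr(DW∘DW)`
(`frobeniusNormSq_fderiv_eq_sq_norm_curl_add_trace`), `tr(DW∘DW) = div((W·∇)W)` for `div W = 0`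
(`divergence_convect_self_eq`), and `∫div((W·∇)W) = 0` (`integral_divergence_eq_zero_of_integrable`: the field
and its divergence are integrable). The `L²` form `‖∇u‖₂ = ‖curl u‖₂` for divergence-free fields is textbook
(Doering–Gibbon 1995, *Applied Analysis of the Navier–Stokes Equations*, (1.4.20)). [folklore] -/
theorem integral_norm_curl_sq_eq_integral_frobeniusNormSq
    {W : EuclideanSpace ℝ (Fin 3) → EuclideanSpace ℝ (Fin 3)} (hW : ContDiff ℝ 2 W)
    (hdiv : VectorCalculus.IsDivFree W)
    (hF : Integrable fun y => frobeniusNormSq (fderiv ℝ W y))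
    (hC : Integrable fun y => ‖curl W y‖ ^ 2)
    (hT : Integrable (convect W W)) :
    ∫ y, ‖curl W y‖ ^ 2 = ∫ y, frobeniusNormSq (fderiv ℝ W y) := by
  have hpt : ∀ y, frobeniusNormSq (fderiv ℝ W y) =
      ‖curl W y‖ ^ 2 + traceCLM ((fderiv ℝ W y).comp (fderiv ℝ W y)) :=
    fun y => frobeniusNormSq_fderiv_eq_sq_norm_curl_add_trace W y
  have hdv : ∀ y, VectorCalculus.divergence (convect W W) y =
      traceCLM ((fderiv ℝ W y).comp (fderiv ℝ W y)) :=
    fun y => divergence_convect_self_eq hW hdiv y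
  have htr : (fun y => traceCLM ((fderiv ℝ W y).comp (fderiv ℝ W y))) =
      fun y => frobeniusNormSq (fderiv ℝ W y) - ‖curl W y‖ ^ 2 := by
    funext y
    rw [hpt y]
    ring
  have itr : Integrable fun y => traceCLM ((fderiv ℝ W y).comp (fderiv ℝ W y)) := by
    rw [htr]
    exact hF.sub hC
  have idv : Integrable fun y => VectorCalculus.divergence (convect W W) y := by
    have : (fun y => VectorCalculus.divergence (convect W W) y) =
        fun y => traceCLM ((fderiv ℝ W y).comp (fderiv ℝ W y)) := funext hdv
    rw [this]
    exact itr
  have hc1 : ContDiff ℝ 1 (convect W W) := by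
    have hW1 : ContDiff ℝ 1 W := hW.of_le (by norm_num)
    have : convect W W = fun y => fderiv ℝ W y (W y) := by funext y; rfl
    rw [this]
    exact (hW.fderiv_right (m := 1) le_rfl).clm_apply hW1
  have h0 : ∫ y, VectorCalculus.divergence (convect W W) y = 0 :=
    integral_divergence_eq_zero_of_integrable hc1 hT idv
  have h1 : ∫ y, traceCLM ((fderiv ℝ W y).comp (fderiv ℝ W y)) = 0 := by
    rw [← h0]
    exact integral_congr_ae (Eventually.of_forall fun y => (hdv y).symm)
  calc ∫ y, ‖curl W y‖ ^ 2
      = ∫ y, (frobeniusNormSq (fderiv ℝ W y) - traceCLM ((fderiv ℝ W y).comp (fderiv ℝ W y))) :=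
        integral_congr_ae (Eventually.of_forall fun y => by dsimp only; rw [hpt y]; ring)
    _ = (∫ y, frobeniusNormSq (fderiv ℝ W y)) -
          ∫ y, traceCLM ((fderiv ℝ W y).comp (fderiv ℝ W y)) := integral_sub hF itr
    _ = ∫ y, frobeniusNormSq (fderiv ℝ W y) := by rw [h1, sub_zero]

/-- `‖curl Ω(s)‖² ∈ L¹(ℝ³)` under (D) at `k = 2`: `‖curl Ω‖² ≤ ‖curlCLM‖² ‖DΩ‖² ≤ ‖curlCLM‖² |DΩ|²_F`
pointwise (`norm_curl_le`, `sq_opNorm_le_frobeniusNormSq`) and `|DΩ(s)|²_F ∈ L¹`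
(`integrable_frobeniusNormSq_fderiv_lerayVorticity`). [folklore] -/
theorem integrable_norm_curl_lerayVorticity_sq (hV : IsTypeIAncientMild M V) {C₂ : ℝ}
    (hD2 : ∀ t < 0, ∀ x, (‖x‖ + Real.sqrt (-t)) ^ (2 + 1) * ‖iteratedFDeriv ℝ 2 (V t) x‖ ≤ C₂)
    (s : ℝ) :
    Integrable fun y => ‖curl (lerayVorticity V s) y‖ ^ 2 := by
  have hΩ := contDiff_lerayVorticity_slice hV s
  have iF := integrable_frobeniusNormSq_fderiv_lerayVorticity hV hD2 s
  have hcurl : Continuous (curl (lerayVorticity V s)) := by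
    rw [curl_eq_curlCLM_comp]
    exact curlCLM.continuous.comp (hΩ.continuous_fderiv (by simp))
  have hcont : Continuous fun y => ‖curl (lerayVorticity V s) y‖ ^ 2 := hcurl.norm.pow 2
  have hle : ∀ y, ‖curl (lerayVorticity V s) y‖ ^ 2 ≤
      ‖curlCLM‖ ^ 2 * frobeniusNormSq (fderiv ℝ (lerayVorticity V s) y) := fun y =>
    calc ‖curl (lerayVorticity V s) y‖ ^ 2
        ≤ (‖curlCLM‖ * ‖fderiv ℝ (lerayVorticity V s) y‖) ^ 2 :=
          pow_le_pow_left₀ (norm_nonneg _) (norm_curl_le (lerayVorticity V s) y) 2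
      _ = ‖curlCLM‖ ^ 2 * ‖fderiv ℝ (lerayVorticity V s) y‖ ^ 2 := by ring
      _ ≤ ‖curlCLM‖ ^ 2 * frobeniusNormSq (fderiv ℝ (lerayVorticity V s) y) :=
          mul_le_mul_of_nonneg_left (sq_opNorm_le_frobeniusNormSq _) (sq_nonneg _)
  refine (iF.const_mul (‖curlCLM‖ ^ 2)).mono' hcont.aestronglyMeasurable
    (Eventually.of_forall fun y => ?_)
  rw [Real.norm_eq_abs, abs_of_nonneg (sq_nonneg _)]
  exact hle y

/-- `(Ω(s)·∇)Ω(s) ∈ L¹(ℝ³; ℝ³)` under (D) at `k = 1, 2` (`‖DΩ Ω‖ ≤ ‖DΩ‖‖Ω‖ ≲ (1+|y|)^{−5}`). [folklore] -/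
theorem integrable_convect_lerayVorticity_self (hV : IsTypeIAncientMild M V) {C₁ C₂ : ℝ}
    (hD1 : ∀ t < 0, ∀ x, (‖x‖ + Real.sqrt (-t)) ^ (1 + 1) * ‖iteratedFDeriv ℝ 1 (V t) x‖ ≤ C₁)
    (hD2 : ∀ t < 0, ∀ x, (‖x‖ + Real.sqrt (-t)) ^ (2 + 1) * ‖iteratedFDeriv ℝ 2 (V t) x‖ ≤ C₂)
    (s : ℝ) :
    Integrable (convect (lerayVorticity V s) (lerayVorticity V s)) := by
  have hΩ := contDiff_lerayVorticity_slice hV s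
  have hcont : Continuous (convect (lerayVorticity V s) (lerayVorticity V s)) := by
    have : convect (lerayVorticity V s) (lerayVorticity V s) =
        fun y => fderiv ℝ (lerayVorticity V s) y (lerayVorticity V s y) := by funext y; rfl
    rw [this]
    exact (hΩ.continuous_fderiv (by simp)).clm_apply hΩ.continuous
  have hK : 0 ≤ (‖curlCLM‖ * C₂) * (‖curlCLM‖ * C₁) := by
    have := decayConst_nonneg hD1; have := decayConst_nonneg hD2; positivity
  have hKc : Continuous fun y : EuclideanSpace ℝ (Fin 3) =>
      (‖curlCLM‖ * C₂) * (‖curlCLM‖ * C₁) * (1 + ‖y‖) ^ (-(4 : ℝ)) :=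
    continuous_const.mul ((continuous_const.add continuous_norm).rpow_const
      fun y => Or.inl (add_pos_of_pos_of_nonneg one_pos (norm_nonneg y)).ne')
  have hmaj : Integrable fun y : EuclideanSpace ℝ (Fin 3) =>
      (‖curlCLM‖ * C₂) * (‖curlCLM‖ * C₁) * (1 + ‖y‖) ^ (-(4 : ℝ)) :=
    integrable_of_le_decay_four hKc (K := (‖curlCLM‖ * C₂) * (‖curlCLM‖ * C₁)) fun y => by
      rw [Real.norm_of_nonneg (mul_nonneg hK (Real.rpow_nonneg (by positivity) _))]
  refine hmaj.mono' hcont.aestronglyMeasurable (Eventually.of_forall fun y => ?_)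
  have h2 := norm_fderiv_lerayVorticity_le_decay hV hD2 s y
  have h3 := norm_lerayVorticity_le_decay hV hD1 s y
  have h20 : 0 ≤ ‖curlCLM‖ * C₂ * (1 + ‖y‖) ^ (-(3 : ℝ)) := (norm_nonneg _).trans h2
  calc ‖convect (lerayVorticity V s) (lerayVorticity V s) y‖
      ≤ ‖fderiv ℝ (lerayVorticity V s) y‖ * ‖lerayVorticity V s y‖ := by
        rw [convect_apply]
        exact ContinuousLinearMap.le_opNorm _ _
    _ ≤ (‖curlCLM‖ * C₂ * (1 + ‖y‖) ^ (-(3 : ℝ))) * (‖curlCLM‖ * C₁ * (1 + ‖y‖) ^ (-(2 : ℝ))) :=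
        mul_le_mul h2 h3 (norm_nonneg _) h20
    _ = (‖curlCLM‖ * C₂) * (‖curlCLM‖ * C₁) * ((1 + ‖y‖) ^ (-(3 : ℝ)) * (1 + ‖y‖) ^ (-(2 : ℝ))) := by
        ring
    _ = (‖curlCLM‖ * C₂) * (‖curlCLM‖ * C₁) * (1 + ‖y‖) ^ (-(5 : ℝ)) := by
        rw [SlabLaw.rpow_neg_mul_rpow_neg]; norm_num
    _ ≤ (‖curlCLM‖ * C₂) * (‖curlCLM‖ * C₁) * (1 + ‖y‖) ^ (-(4 : ℝ)) :=
        mul_le_mul_of_nonneg_left (SlabLaw.rpow_neg_le_rpow_neg_of_le y (by norm_num)) hK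

/-- **`∫‖curl Ω(s)‖² = ∫|∇Ω(s)|²_F` for the similarity vorticity of a KNSS-gauge Type-I field under (D) at
`k = 1, 2`** (`Ω = curl U` is divergence-free and decays with its gradient; instance of
`integral_norm_curl_sq_eq_integral_frobeniusNormSq`). This identity is what keeps the Λ-directional threshold at
`1`. [this file; folklore] -/
theorem integral_norm_curl_lerayVorticity_sq_eq (hV : IsTypeIAncientMild M V) {C₁ C₂ : ℝ}
    (hD1 : ∀ t < 0, ∀ x, (‖x‖ + Real.sqrt (-t)) ^ (1 + 1) * ‖iteratedFDeriv ℝ 1 (V t) x‖ ≤ C₁)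
    (hD2 : ∀ t < 0, ∀ x, (‖x‖ + Real.sqrt (-t)) ^ (2 + 1) * ‖iteratedFDeriv ℝ 2 (V t) x‖ ≤ C₂)
    (s : ℝ) :
    ∫ y, ‖curl (lerayVorticity V s) y‖ ^ 2 =
      ∫ y, frobeniusNormSq (fderiv ℝ (lerayVorticity V s) y) := by
  have hΩ := contDiff_lerayVorticity_slice hV s
  have hU : ContDiff ℝ ∞ (lerayOrbit V s) := contDiff_lerayOrbit_slice_of_typeI hV s le_rfl
  have hdiv : VectorCalculus.IsDivFree (lerayVorticity V s) := fun y =>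
    divergence_curl_eq_zero_holds _ (hU.of_le (by norm_cast)) y
  exact integral_norm_curl_sq_eq_integral_frobeniusNormSq (hΩ.of_le (by norm_cast)) hdiv
    (integrable_frobeniusNormSq_fderiv_lerayVorticity hV hD2 s)
    (integrable_norm_curl_lerayVorticity_sq hV hD2 s)
    (integrable_convect_lerayVorticity_self hV hD1 hD2 s)

end Summit.NavierStokesRegularity.NavierStokesRegularity.Theorems.SimilarityEnstrophy
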